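import Summits.ResolutionOfSingularities.ResolutionOfSingularities.Theorems.FrobeniusClosingPatchingRelPerfectDepthPhaseCStepStalk
import Summits.ResolutionOfSingularities.ResolutionOfSingularities.Theorems.FrobeniusClosingPatchingRelPerfectDepthMultiHostCyl
import Literature.AlgebraicGeometry.Resolution.SncSaturatedCentre
import Literature.AlgebraicGeometry.Resolution.BlowupChartMembership
import HarnessLib

/-!
# Crux `PatchingRelPerfect` (stmt-ResolutionOfSingularities-16161), chain W5.2 — F7(β) (β-AX) X3 C-I: MEMBER HIT, LEMMA V and
# SWALLOWING as POINTWISE corollaries of (virtual) N-DOMINATION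

[OURS · L1 W5.2 · res-L1-w52-plan-1 RULING G12-23 (2) / G12-27 (B) (res-L1-w52-idea-1 WORD P «P := NDominates», res-L1-w52-lead-1
RESHAPE «VIRTUAL form» + corollary currency 19:59:30Z (3)), hand res-L1-w52-stub-2 g6]  The bookkeeping clause `NDominates` gives,
at a point `x` off `Supp Z` (`Z` = the carrier, at the positions `< n₀` of `S.𝓔`), a VIRTUAL N-SUMMAND: an exponent list `𝓝` on
`S.𝓔` with `monomialIdeal 𝓝 ≤ K` whose exponents `n_j := (𝓝.map Prod.snd).getD j 0` are DOMINATED (`n_j ≤ S.expAt i j`) on the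
members through `x` at positions `≥ n₀` by every summand `i` whose HOST lies in `𝔪_x²`.  The honest case `𝓝 := S.exps N` (`N` a
summand with UNIT host at `x`) is the «∃N-summand» form.  THIS FILE derives, pointwise, without cylinder identities, in the stalk
currency of (n1) `…DepthPhaseCStepStalk` and of `K = M · K♭` (`…DepthMultiHostResidual`):

* `monomial_stalk_le_of_noHit` + `residual_stalk_eq_top_of_monomial_stalk_le` — the CARTIER CANCELLATION: a summand with no residual
  factor through `x` that dominates a virtual summand forces `M_x ≤ (monomialIdeal 𝓝)_x ≤ K_x = M_x · K♭_x`, so `K♭_x = ⊤`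
  (`M_x = (g)`, `g` a nonzerodivisor: `isEffectiveCartier_monomialIdeal_minExps`);
* **`residual_stalk_le_members_of_virtual`** (core, `T ≠ Z` currency, one virtual summand per bad host, stalk-level `≤ K_x`),
  **`residual_stalk_le_members_of_nDominatesAt`** (lead-1΄s prefix currency) and `residual_stalk_le_members_of_dominates` (∃N form)
  — LEMMA V / MEMBER HIT: at `x ∈ cosupp K♭` off `Supp Z` with NO local carrier (no residual stalk element outside `𝔪_x²`),
  `K♭_x ≤ ⨆_{T ∈ S.𝓔, x ∈ Supp T} T_x` (a carrier-free non-hit summand has host in `𝔪_x²`; then the cancellation bites);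
* **`memberHitOffZ_of_nDominates`** = «`NDominates S cyl → MemberHitOffZ S cyl`» with lead-1΄s `NDominates` (`…ReachNDomDefs`) and
  idea-1΄s `MemberHitOffZ` / `HasLocalCarrierAt` / `HasMemberHitAt` (Sketch v17) UNFOLDED verbatim (`Supp cyl.j.ker = range j`);
* `virtualResidual_stalk_le` + **`swallowsAt_of_virtual`** / **`swallowsAt_of_nDominatesAt`** — SWALLOWING (c′) off `Supp Z`: with
  the MEMBER MONOMIAL `𝔑 := monomialIdeal [(S.𝓔[j], max n_j μ_j − μ_j)]_j`, `𝔑_x ≤ K♭_x` and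
  `K♭_x = (⨆_{i : (host i)_x ⊄ 𝔪_x²} (host i · monomialIdeal (residualExps i))_x) ⊔ 𝔑_x`; «`n_j ≥ μ_j`» is never needed — `n` is
  replaced by `max n μ`, still `≤ K_x`, still dominated since `μ_j ≤ expAt i j`.
Fact-free; nothing here is a statement of the manuscript under review (AI-written; AI review weaker than expert review).

## References

* J. Kollár, *Lectures on Resolution of Singularities* (2007), (3.111) Step 3. [Kollar2007]
* E. Bierstone, D. Grigoriev, P. Milman, J. Włodarczyk, arXiv:1206.3090, §4 Step 2b. [BierstoneGrigorievMilmanWlodarczyk2011]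
-/

-- `Summit.<Summit>.<Sub>.Theorems` with `Sub = Summit` (single-conjunct summit, D-0017)
set_option linter.dupNamespace false

noncomputable section

open CategoryTheory AlgebraicGeometry TopologicalSpace IsLocalRing
open Literature.AlgebraicGeometry.Resolution
open Scheme.IdealSheafData

namespace Summit.ResolutionOfSingularities.ResolutionOfSingularities.Theorems.DepthMultiHost

universe u

variable {X : Scheme.{u}}

/-! ## §0 Products of ideals along a list -/

section Lists

/-- Position-wise comparison of two products of ideals along lists of the same length. [folklore] -/
theorem prod_map_le_of_getElem {α β R : Type*} [CommSemiring R] :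
    ∀ (l₁ : List α) (l₂ : List β) (f : α → Ideal R) (g : β → Ideal R), l₁.length = l₂.length →
      (∀ (j : ℕ) (h₁ : j < l₁.length) (h₂ : j < l₂.length), f l₁[j] ≤ g l₂[j]) →
      (l₁.map f).prod ≤ (l₂.map g).prod
  | [], [], _, _, _, _ => le_rfl
  | [], _ :: _, _, _, h, _ => by simp at h
  | _ :: _, [], _, _, h, _ => by simp at h
  | a :: l₁, b :: l₂, f, g, h, hle => by
    rw [List.map_cons, List.map_cons, List.prod_cons, List.prod_cons]
    exact Ideal.mul_mono (hle 0 (by simp) (by simp))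
      (prod_map_le_of_getElem l₁ l₂ f g (by simpa using h) fun j h₁ h₂ =>
        hle (j + 1) (by simpa using h₁) (by simpa using h₂))

/-- A product of ideals along a list is the unit ideal when every factor is. [folklore] -/
theorem prod_map_eq_top {ι R : Type*} [CommSemiring R] (l : List ι) (f : ι → Ideal R) (h : ∀ a ∈ l, f a = ⊤) :
    (l.map f).prod = ⊤ := by
  rw [← Ideal.one_eq_top]
  exact List.prod_eq_one fun J hJ => by
    obtain ⟨a, ha, rfl⟩ := List.mem_map.mp hJ
    rw [h a ha, Ideal.one_eq_top]

/-- The second component at position `j` of a list of pairs, as a default-zero lookup. [folklore] -/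
theorem getElem_snd_eq_getD {α : Type*} (l : List (α × ℕ)) {j : ℕ} (hj : j < l.length) :
    (l[j]).2 = (l.map Prod.snd).getD j 0 := by
  rw [List.getD_eq_getElem?_getD, List.getElem?_map, List.getElem?_eq_getElem hj]; rfl

/-- **Cancellation of a nonzerodivisor principal factor**: `(g)·A ≤ (g)·B ⇒ A ≤ B`. [folklore] -/
theorem le_of_span_singleton_mul_le {R : Type*} [CommRing R] {g : R} (hg : g ∈ nonZeroDivisors R) {A B : Ideal R}
    (h : Ideal.span {g} * A ≤ Ideal.span {g} * B) : A ≤ B := fun a ha => by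
  obtain ⟨b, hb, hab⟩ := Ideal.mem_span_singleton_mul.mp (h (Ideal.mul_mem_mul (Ideal.mem_span_singleton_self g) ha))
  have hba : b = a := (mul_cancel_right_mem_nonZeroDivisors hg).mp (by rw [mul_comm b, mul_comm a]; exact hab)
  exact hba ▸ hb

/-- Two position-wise stalk monomials along the same member list multiply exponent-wise. [folklore] -/
theorem prod_map_mapIdx_stalk_mul (x : X) :
    ∀ (L : List X.IdealSheafData) (a b : ℕ → ℕ),
      ((L.mapIdx fun j T => (T, a j)).map fun p => stalkIdeal p.1 x ^ p.2).prod *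
          ((L.mapIdx fun j T => (T, b j)).map fun p => stalkIdeal p.1 x ^ p.2).prod =
        ((L.mapIdx fun j T => (T, a j + b j)).map fun p => stalkIdeal p.1 x ^ p.2).prod
  | [], _, _ => by simp
  | T :: L, a, b => by
    have ih := prod_map_mapIdx_stalk_mul x L (fun j => a (j + 1)) (fun j => b (j + 1))
    simp only [List.mapIdx_cons, List.map_cons, List.prod_cons] at ih ⊢
    rw [pow_add, ← ih]; exact mul_mul_mul_comm _ _ _ _

end Lists

namespace MultiHostState

variable (S : MultiHostState X)

/-! ## §1 Positional bookkeeping of the residual exponents -/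

/-- An exponent list on `S.𝓔` has the length of the member family. [folklore] -/
theorem length_eq_of_boundaryOf (𝓝 : List (X.IdealSheafData × ℕ)) (h : boundaryOf 𝓝 = S.𝓔) : 𝓝.length = S.𝓔.length := by
  rw [← h]; exact (List.length_map _).symm

/-- The member at position `j` of an exponent list on `S.𝓔` is `S.𝓔[j]`. [folklore] -/
theorem getElem_fst_of_boundaryOf (𝓝 : List (X.IdealSheafData × ℕ)) (h : boundaryOf 𝓝 = S.𝓔) {j : ℕ} (hj : j < 𝓝.length) :
    (𝓝[j]).1 = S.𝓔[j]'(by rw [← S.length_eq_of_boundaryOf 𝓝 h]; exact hj) := by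
  have h1 := List.getElem_map (f := Prod.fst) (l := 𝓝) (h := by rw [List.length_map]; exact hj)
  rw [← h1]; congr 1

/-- **Entry `j` of an exponent list on `S.𝓔`**: `(S.𝓔[j], n_j)` with `n_j := (𝓝.map Prod.snd).getD j 0`. [folklore] -/
theorem getElem_eq_of_boundaryOf (𝓝 : List (X.IdealSheafData × ℕ)) (h : boundaryOf 𝓝 = S.𝓔) {j : ℕ} (hj : j < 𝓝.length) :
    𝓝[j] = (S.𝓔[j]'(by rw [← S.length_eq_of_boundaryOf 𝓝 h]; exact hj), (𝓝.map Prod.snd).getD j 0) :=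
  Prod.ext (S.getElem_fst_of_boundaryOf 𝓝 h hj) (getElem_snd_eq_getD 𝓝 hj)

/-- An exponent list on `S.𝓔` is `S.𝓔` re-paired with its exponents, under any map. [folklore] -/
theorem map_eq_of_boundaryOf {β : Type*} (𝓝 : List (X.IdealSheafData × ℕ)) (h : boundaryOf 𝓝 = S.𝓔)
    (F : X.IdealSheafData × ℕ → β) :
    𝓝.map F = (S.𝓔.mapIdx fun j T => (T, (𝓝.map Prod.snd).getD j 0)).map F := by
  apply List.ext_getElem
  · rw [List.length_map, List.length_map, List.length_mapIdx, S.length_eq_of_boundaryOf 𝓝 h]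
  · intro j h₁ h₂
    rw [List.length_map] at h₁
    simp only [List.getElem_map, List.getElem_mapIdx]
    rw [S.getElem_eq_of_boundaryOf 𝓝 h h₁]

/-- The residual exponent list has the length of the member family. [folklore] -/
theorem length_residualExps (i : Fin S.n) : (S.residualExps i).length = S.𝓔.length := by
  unfold residualExps; rw [List.length_mapIdx, S.length_exps i]

/-- **The residual entry at position `j`**: `(S.𝓔[j], expAt i j − minExpAt j)`. [cite: Kollar2007, (3.111) Step 3] -/
theorem getElem_residualExps (i : Fin S.n) {j : ℕ} (hj : j < (S.residualExps i).length) :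
    (S.residualExps i)[j] =
      (S.𝓔[j]'(by rw [← S.length_residualExps i]; exact hj), S.expAt i j - S.minExpAt j) := by
  have hj' : j < (S.exps i).length := by rw [S.length_exps i, ← S.length_residualExps i]; exact hj
  unfold residualExps; rw [List.getElem_mapIdx]
  exact Prod.ext (S.getElem_fst_of_boundaryOf (S.exps i) (S.boundaryOf_exps i) hj')
    (congrArg (· - S.minExpAt j) (getElem_snd_eq_getD (S.exps i) hj'))

/-- The entry of position `j` is in the list. [folklore] -/
theorem mem_residualExps_of_lt (i : Fin S.n) {j : ℕ} (hj : j < S.𝓔.length) :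
    (S.𝓔[j], S.expAt i j - S.minExpAt j) ∈ S.residualExps i :=
  List.mem_iff_getElem.mpr ⟨j, by rw [S.length_residualExps i]; exact hj, S.getElem_residualExps i _⟩

/-- The monomial part has the length of the member family. [folklore] -/
theorem length_minExps : S.minExps.length = S.𝓔.length := by
  unfold minExps; rw [List.length_mapIdx]

/-- **Entry `j` of the monomial part**: `(S.𝓔[j], minExpAt j)`. [folklore] -/
theorem getElem_minExps {j : ℕ} (hj : j < S.minExps.length) :
    S.minExps[j] = (S.𝓔[j]'(by rw [← S.length_minExps]; exact hj), S.minExpAt j) := by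
  unfold minExps; rw [List.getElem_mapIdx]

/-! ## §2 The Cartier cancellation behind a virtual N-summand -/

/-- **A virtual summand dominated by a NON-HIT summand contains the monomial part at the point**: off `Supp Z`, if summand `i` has no
residual factor through `x` and `n_j ≤ expAt i j` on the members through `x` other than `Z`, then `M_x ≤ (monomialIdeal 𝓝)_x`.
[folklore] -/
theorem monomial_stalk_le_of_noHit (x : X) (Z : X.IdealSheafData) (hxZ : x ∉ (Z.support : Set X)) (i : Fin S.n)
    (hhit : ∀ p ∈ S.residualExps i, p.2 ≠ 0 → x ∉ (p.1.support : Set X))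
    (𝓝 : List (X.IdealSheafData × ℕ)) (h𝓝 : boundaryOf 𝓝 = S.𝓔)
    (hdom : ∀ (j : ℕ) (T : X.IdealSheafData), S.𝓔[j]? = some T → T ≠ Z → x ∈ (T.support : Set X) →
      (𝓝.map Prod.snd).getD j 0 ≤ S.expAt i j) :
    stalkIdeal (monomialIdeal S.minExps) x ≤ stalkIdeal (monomialIdeal 𝓝) x := by
  rw [stalkIdeal_monomialIdeal, stalkIdeal_monomialIdeal]
  refine prod_map_le_of_getElem _ _ _ _ (by rw [S.length_minExps, S.length_eq_of_boundaryOf 𝓝 h𝓝]) fun j h₁ h₂ => ?_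
  have hj : j < S.𝓔.length := by rw [← S.length_minExps]; exact h₁
  rw [S.getElem_minExps h₁, S.getElem_eq_of_boundaryOf 𝓝 h𝓝 h₂]
  change stalkIdeal (S.𝓔[j]) x ^ S.minExpAt j ≤ stalkIdeal (S.𝓔[j]) x ^ (𝓝.map Prod.snd).getD j 0
  by_cases hxj : x ∈ ((S.𝓔[j]).support : Set X)
  · have hne : S.𝓔[j] ≠ Z := fun h => hxZ (h ▸ hxj)
    have h1 := hdom j _ (List.getElem?_eq_getElem hj) hne hxj
    have h2 : S.expAt i j - S.minExpAt j = 0 := by_contra fun h0 => hhit _ (S.mem_residualExps_of_lt i hj) h0 hxj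
    have h3 := S.minExpAt_le i j
    exact Ideal.pow_le_pow_right (by omega)
  · rw [stalkIdeal_eq_top_of_not_mem_support hxj, Ideal.top_pow, Ideal.top_pow]

/-- **CARTIER CANCELLATION**: if the monomial part΄s stalk lies in `K_x = M_x · K♭_x`, then `K♭_x = ⊤` — `M_x = (g)` with `g` a
nonzerodivisor (`isEffectiveCartier_monomialIdeal_minExps`). [folklore] -/
theorem residual_stalk_eq_top_of_monomial_stalk_le [IsLocallyNoetherian X] (x : X)
    (h : stalkIdeal (monomialIdeal S.minExps) x ≤ stalkIdeal S.K x) : stalkIdeal S.residual.K x = ⊤ := by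
  obtain ⟨g, hg, hM⟩ := S.isEffectiveCartier_monomialIdeal_minExps.exists_stalkIdeal_eq_span x
  rw [S.K_eq_monomial_mul_residual, stalkIdeal_mul, hM] at h
  exact top_le_iff.mp (le_of_span_singleton_mul_le hg (A := ⊤) (by rwa [Ideal.mul_top]))

/-- **The member monomial of a virtual summand lies in the residual stalk**: if `(monomialIdeal 𝓝)_x ≤ K_x` for an exponent list `𝓝`
on `S.𝓔`, then `𝔑_x ≤ K♭_x` for `𝔑 := monomialIdeal [(S.𝓔[j], max n_j μ_j − μ_j)]_j` — cancel the nonzerodivisor generator of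
`M_x` in `M_x · 𝔑_x = (∏_j T_j^{max n_j μ_j})_x ≤ (monomialIdeal 𝓝)_x ≤ K_x = M_x · K♭_x`. [cite: Kollar2007, (3.111) Step 3] -/
theorem virtualResidual_stalk_le [IsLocallyNoetherian X] (x : X) (𝓝 : List (X.IdealSheafData × ℕ)) (h𝓝 : boundaryOf 𝓝 = S.𝓔)
    (h𝓝K : stalkIdeal (monomialIdeal 𝓝) x ≤ stalkIdeal S.K x) :
    stalkIdeal (monomialIdeal (S.𝓔.mapIdx fun j T =>
        (T, max ((𝓝.map Prod.snd).getD j 0) (S.minExpAt j) - S.minExpAt j))) x ≤ stalkIdeal S.residual.K x := by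
  obtain ⟨g, hg, hM⟩ := S.isEffectiveCartier_monomialIdeal_minExps.exists_stalkIdeal_eq_span x
  have hK : stalkIdeal S.K x = stalkIdeal (monomialIdeal S.minExps) x * stalkIdeal S.residual.K x := by
    rw [S.K_eq_monomial_mul_residual, stalkIdeal_mul]
  refine le_of_span_singleton_mul_le hg ?_
  rw [← hM, ← hK]
  refine le_trans ?_ h𝓝K
  simp only [stalkIdeal_monomialIdeal]
  rw [S.map_eq_of_boundaryOf 𝓝 h𝓝 (fun p => stalkIdeal p.1 x ^ p.2)]
  unfold minExps
  rw [prod_map_mapIdx_stalk_mul]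
  refine prod_map_le_of_getElem _ _ _ _ (by rw [List.length_mapIdx, List.length_mapIdx]) fun j h₁ h₂ => ?_
  simp only [List.getElem_mapIdx]
  exact Ideal.pow_le_pow_right (by omega)

/-! ## §3 Member hit / LEMMA V from (virtual) N-domination -/

/-- **MEMBER HIT and LEMMA V from VIRTUAL N-DOMINATION.** At a point `x` of `cosupp K♭` off `Supp Z`, with no local carrier (no
residual stalk element outside `𝔪_x²`), if every summand whose host has order `≥ 2` at `x` dominates, on the members through `x`
other than `Z`, a virtual summand `𝓝` (`(monomialIdeal 𝓝)_x ≤ K_x`), then `K♭_x ≤ ⨆_{T ∈ S.𝓔, x ∈ Supp T} T_x`.  Indeed a summand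
without a member factor through `x` would be carrier-free only with a host of order `≥ 2`, and then the Cartier cancellation gives
`K♭_x = ⊤`. [cite: Kollar2007, (3.111) Step 3] -/
theorem residual_stalk_le_members_of_virtual [IsLocallyNoetherian X] (x : X) (Z : X.IdealSheafData)
    (hxZ : x ∉ (Z.support : Set X)) (hx : x ∈ (S.residual.K.support : Set X))
    (hcar : ¬ ∃ v ∈ stalkIdeal S.residual.K x, v ∉ (maximalIdeal (X.presheaf.stalk x)) ^ 2)
    (hdom : ∀ i : Fin S.n, stalkIdeal (S.host i) x ≤ (maximalIdeal (X.presheaf.stalk x)) ^ 2 →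
      ∃ 𝓝 : List (X.IdealSheafData × ℕ), boundaryOf 𝓝 = S.𝓔 ∧ stalkIdeal (monomialIdeal 𝓝) x ≤ stalkIdeal S.K x ∧
        ∀ (j : ℕ) (T : X.IdealSheafData), S.𝓔[j]? = some T → T ≠ Z → x ∈ (T.support : Set X) →
          (𝓝.map Prod.snd).getD j 0 ≤ S.expAt i j) :
    stalkIdeal S.residual.K x ≤
      ⨆ (T : X.IdealSheafData) (_ : T ∈ S.𝓔 ∧ x ∈ (T.support : Set X)), stalkIdeal T x := by
  have hKx : stalkIdeal S.residual.K x ≠ ⊤ := (mem_support_iff_stalkIdeal_ne_top _ x).mp hx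
  rw [stalkIdeal_residual_K] at hKx ⊢
  refine iSup_le fun i => ?_
  by_cases hhit : ∃ p ∈ S.residualExps i, p.2 ≠ 0 ∧ x ∈ (p.1.support : Set X)
  · obtain ⟨p, hp, hp0, hxp⟩ := hhit
    exact (S.residualSummand_stalk_le_of_mem x i hp hp0).trans
      (le_iSup₂ (f := fun (T : X.IdealSheafData) (_ : T ∈ S.𝓔 ∧ x ∈ (T.support : Set X)) => stalkIdeal T x)
        p.1 ⟨S.fst_mem_𝓔_of_mem_residualExps hp, hxp⟩)
  · exfalso -- no member factor through `x`: the summand is its host stalk, and this case is contradictory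
    simp only [not_exists, not_and] at hhit
    have hold : ((S.residualExps i).map fun p => stalkIdeal p.1 x ^ p.2).prod = ⊤ :=
      prod_map_eq_top _ _ fun p hp => by
        by_cases h0 : p.2 = 0
        · rw [h0, pow_zero, Ideal.one_eq_top]
        · rw [stalkIdeal_eq_top_of_not_mem_support (hhit p hp h0), Ideal.top_pow]
    have hi : stalkIdeal (S.host i) x ≤ stalkIdeal S.residual.K x := by
      rw [stalkIdeal_residual_K]
      simpa only [hold, Ideal.mul_top] using
        le_iSup (fun k : Fin S.n => stalkIdeal (S.host k) x * ((S.residualExps k).map fun p => stalkIdeal p.1 x ^ p.2).prod) i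
    have hsq : stalkIdeal (S.host i) x ≤ (maximalIdeal (X.presheaf.stalk x)) ^ 2 := fun v hv =>
      by_contra fun hv2 => hcar ⟨v, hi hv, hv2⟩
    obtain ⟨𝓝, h𝓝, h𝓝K, hNdom⟩ := hdom i hsq
    exact hKx (S.stalkIdeal_residual_K x ▸ S.residual_stalk_eq_top_of_monomial_stalk_le x
      ((S.monomial_stalk_le_of_noHit x Z hxZ i hhit 𝓝 h𝓝 hNdom).trans h𝓝K))

/-- **MEMBER HIT and LEMMA V, ∃N-SUMMAND FORM**: the dominated virtual summand is an honest summand `N` with UNIT host at `x`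
(`𝓝 := S.exps N`). [cite: Kollar2007, (3.111) Step 3] -/
theorem residual_stalk_le_members_of_dominates [IsLocallyNoetherian X] (x : X) (Z : X.IdealSheafData)
    (hxZ : x ∉ (Z.support : Set X)) (hx : x ∈ (S.residual.K.support : Set X))
    (hcar : ¬ ∃ v ∈ stalkIdeal S.residual.K x, v ∉ (maximalIdeal (X.presheaf.stalk x)) ^ 2)
    (hdom : ∀ i : Fin S.n, stalkIdeal (S.host i) x ≤ (maximalIdeal (X.presheaf.stalk x)) ^ 2 →
      ∃ N : Fin S.n, x ∉ ((S.host N).support : Set X) ∧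
        ∀ (j : ℕ) (T : X.IdealSheafData), S.𝓔[j]? = some T → T ≠ Z → x ∈ (T.support : Set X) →
          S.expAt N j ≤ S.expAt i j) :
    stalkIdeal S.residual.K x ≤
      ⨆ (T : X.IdealSheafData) (_ : T ∈ S.𝓔 ∧ x ∈ (T.support : Set X)), stalkIdeal T x :=
  S.residual_stalk_le_members_of_virtual x Z hxZ hx hcar fun i hi => by
    obtain ⟨N, hN, hNdom⟩ := hdom i hi
    refine ⟨S.exps N, S.boundaryOf_exps N, ?_, fun j T hT hne hxT => ?_⟩
    · rw [stalkIdeal_K]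
      refine le_iSup_of_le N (le_of_eq ?_)
      rw [stalkIdeal_eq_top_of_not_mem_support hN, Ideal.top_mul]
    · exact hNdom j T hT hne hxT

/-- The carrier's support is the range of the carrier immersion. [folklore] -/
theorem coe_support_ker_j (cyl : CylState S) : ((cyl.j.ker).support : Set X) = Set.range cyl.j.base := by
  haveI := cyl.closedImmersion; rw [Scheme.Hom.support_ker, cyl.j.isClosedEmbedding.isClosed_range.closure_eq]

/-- **Prefix form ⇒ `T ≠ Z` form of domination**: if the positions `< n₀` carry `Z`, domination on the positions `≥ n₀` is
domination on the members other than `Z` (res-L1-w52-lead-1΄s pointwise currency, 19:59:30Z (3)). [folklore] -/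
theorem dominates_of_prefix (x : X) (Z : X.IdealSheafData) (n₀ : ℕ) (𝓝 : List (X.IdealSheafData × ℕ))
    (hpfx : ∀ j < n₀, S.𝓔[j]? = some Z) {i : Fin S.n}
    (hdom : ∀ j : ℕ, n₀ ≤ j → ∀ T : X.IdealSheafData, S.𝓔[j]? = some T → x ∈ (T.support : Set X) →
      (𝓝.map Prod.snd).getD j 0 ≤ S.expAt i j) :
    ∀ (j : ℕ) (T : X.IdealSheafData), S.𝓔[j]? = some T → T ≠ Z → x ∈ (T.support : Set X) →
      (𝓝.map Prod.snd).getD j 0 ≤ S.expAt i j := fun j T hT hne hxT => by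
  by_cases hj : j < n₀
  · exact absurd (Option.some.inj ((hpfx j hj).symm.trans hT)) hne.symm
  · exact hdom j (not_lt.mp hj) T hT hxT

/-- **MEMBER HIT / LEMMA V in res-L1-w52-lead-1΄s pointwise `NDominates` currency** (prefix `n₀` of carrier positions, ONE virtual
summand `𝓝` with `monomialIdeal 𝓝 ≤ K`, domination on the positions `≥ n₀`; the «sum `≤ 2`» conjunct is not needed pointwise).
[cite: Kollar2007, (3.111) Step 3] -/
theorem residual_stalk_le_members_of_nDominatesAt [IsLocallyNoetherian X] (x : X) (Z : X.IdealSheafData)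
    (hxZ : x ∉ (Z.support : Set X)) (hx : x ∈ (S.residual.K.support : Set X))
    (hcar : ¬ ∃ v ∈ stalkIdeal S.residual.K x, v ∉ (maximalIdeal (X.presheaf.stalk x)) ^ 2)
    (n₀ : ℕ) (𝓝 : List (X.IdealSheafData × ℕ)) (hbd : boundaryOf 𝓝 = S.𝓔) (hle : monomialIdeal 𝓝 ≤ S.K)
    (hpfx : ∀ j < n₀, S.𝓔[j]? = some Z)
    (hdom : ∀ i : Fin S.n, stalkIdeal (S.host i) x ≤ (maximalIdeal (X.presheaf.stalk x)) ^ 2 →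
      ∀ j : ℕ, n₀ ≤ j → ∀ T : X.IdealSheafData, S.𝓔[j]? = some T → x ∈ (T.support : Set X) →
        (𝓝.map Prod.snd).getD j 0 ≤ S.expAt i j) :
    stalkIdeal S.residual.K x ≤
      ⨆ (T : X.IdealSheafData) (_ : T ∈ S.𝓔 ∧ x ∈ (T.support : Set X)), stalkIdeal T x :=
  S.residual_stalk_le_members_of_virtual x Z hxZ hx hcar fun i hi =>
    ⟨𝓝, hbd, stalkIdeal_mono hle x, S.dominates_of_prefix x Z n₀ 𝓝 hpfx (hdom i hi)⟩

/-- **`NDominates → MemberHitOffZ`, both UNFOLDED** (res-L1-w52-lead-1΄s VIRTUAL `NDominates` of RULING G12-27 (B): a prefix `n₀` of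
carrier positions, a virtual summand `𝓝` with `monomialIdeal 𝓝 ≤ K`, carrier exponents totalling `≤ 2`, domination on the positions
`≥ n₀` at the points where a host has order `≥ 2`; res-L1-w52-idea-1΄s `MemberHitOffZ` of Sketch v17): member hit at every
carrier-free point of the residual cosupport off `range j`.  The carrier-exponent bound is carried but not used here.
[cite: Kollar2007, (3.111) Step 3] -/
theorem memberHitOffZ_of_nDominates {X : Scheme.{u}} [IsLocallyNoetherian X] (S : MultiHostState X) (cyl : CylState S)
    (hN : ∃ (n₀ : ℕ) (𝓝 : List (X.IdealSheafData × ℕ)), boundaryOf 𝓝 = S.𝓔 ∧ monomialIdeal 𝓝 ≤ S.K ∧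
      (∀ j < n₀, S.𝓔[j]? = some cyl.j.ker) ∧ ((𝓝.map Prod.snd).take n₀).sum ≤ 2 ∧
      ∀ (i : Fin S.n) (x : X), stalkIdeal (S.host i) x ≤ (maximalIdeal (X.presheaf.stalk x)) ^ 2 →
        ∀ j : ℕ, n₀ ≤ j → ∀ T : X.IdealSheafData, S.𝓔[j]? = some T → x ∈ (T.support : Set X) →
          (𝓝.map Prod.snd).getD j 0 ≤ S.expAt i j) :
    ∀ x ∈ (S.residual.K.support : Set X), x ∉ Set.range cyl.j.base →
      (¬ ∃ v ∈ stalkIdeal S.residual.K x, v ∉ (maximalIdeal (X.presheaf.stalk x)) ^ 2) →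
      stalkIdeal S.residual.K x ≤
        ⨆ (T : X.IdealSheafData) (_ : T ∈ S.𝓔 ∧ x ∈ (T.support : Set X)), stalkIdeal T x := fun x hx hxj hcar => by
  obtain ⟨n₀, 𝓝, hbd, hle, hpfx, -, hdom⟩ := hN
  exact S.residual_stalk_le_members_of_nDominatesAt x cyl.j.ker (by rw [S.coe_support_ker_j cyl]; exact hxj) hx hcar n₀ 𝓝 hbd
    hle hpfx fun i hi => hdom i x hi

/-! ## §4 Swallowing at a point off `Supp Z` -/

/-- **SWALLOWING (c′) from virtual N-domination**: off `Supp Z`, the residual stalk is generated by the terms whose host germ has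
order `≤ 1` at `x` together with the MEMBER MONOMIAL `𝔑_x`, `𝔑 := monomialIdeal [(S.𝓔[j], max n_j μ_j − μ_j)]_j`, of a virtual
summand `𝓝` dominated by every summand whose host lies in `𝔪_x²`. [cite: Kollar2007, (3.111) Step 3] -/
theorem swallowsAt_of_virtual [IsLocallyNoetherian X] (x : X) (Z : X.IdealSheafData) (hxZ : x ∉ (Z.support : Set X))
    (𝓝 : List (X.IdealSheafData × ℕ)) (h𝓝 : boundaryOf 𝓝 = S.𝓔) (h𝓝K : stalkIdeal (monomialIdeal 𝓝) x ≤ stalkIdeal S.K x)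
    (hdom : ∀ i : Fin S.n, stalkIdeal (S.host i) x ≤ (maximalIdeal (X.presheaf.stalk x)) ^ 2 →
      ∀ (j : ℕ) (T : X.IdealSheafData), S.𝓔[j]? = some T → T ≠ Z → x ∈ (T.support : Set X) →
        (𝓝.map Prod.snd).getD j 0 ≤ S.expAt i j) :
    stalkIdeal S.residual.K x =
      (⨆ (i : Fin S.n) (_ : ¬ stalkIdeal (S.host i) x ≤ (maximalIdeal (X.presheaf.stalk x)) ^ 2),
        stalkIdeal (S.host i * monomialIdeal (S.residualExps i)) x) ⊔
      stalkIdeal (monomialIdeal (S.𝓔.mapIdx fun j T =>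
        (T, max ((𝓝.map Prod.snd).getD j 0) (S.minExpAt j) - S.minExpAt j))) x := by
  have hterm : ∀ k : Fin S.n, stalkIdeal (S.host k * monomialIdeal (S.residualExps k)) x =
      stalkIdeal (S.host k) x * ((S.residualExps k).map fun p => stalkIdeal p.1 x ^ p.2).prod := fun k => by
    rw [stalkIdeal_mul, stalkIdeal_monomialIdeal]
  apply le_antisymm
  · rw [stalkIdeal_residual_K]
    refine iSup_le fun i => ?_
    by_cases hi : stalkIdeal (S.host i) x ≤ (maximalIdeal (X.presheaf.stalk x)) ^ 2
    · -- a summand with host in `𝔪_x²` is swallowed by the member monomial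
      refine le_sup_of_le_right (Ideal.mul_le_left.trans ?_)
      rw [stalkIdeal_monomialIdeal]
      refine prod_map_le_of_getElem _ _ _ _ (by rw [S.length_residualExps, List.length_mapIdx]) fun j h₁ h₂ => ?_
      have hj : j < S.𝓔.length := by rw [← S.length_residualExps i]; exact h₁
      rw [S.getElem_residualExps i h₁]
      simp only [List.getElem_mapIdx]
      change stalkIdeal (S.𝓔[j]) x ^ (S.expAt i j - S.minExpAt j) ≤
        stalkIdeal (S.𝓔[j]) x ^ (max ((𝓝.map Prod.snd).getD j 0) (S.minExpAt j) - S.minExpAt j)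
      by_cases hxj : x ∈ ((S.𝓔[j]).support : Set X)
      · have hne : S.𝓔[j] ≠ Z := fun h => hxZ (h ▸ hxj)
        have h1 := hdom i hi j _ (List.getElem?_eq_getElem hj) hne hxj
        have h3 := S.minExpAt_le i j
        exact Ideal.pow_le_pow_right (by omega)
      · rw [stalkIdeal_eq_top_of_not_mem_support hxj, Ideal.top_pow, Ideal.top_pow]
    · refine le_sup_of_le_left ?_
      rw [← hterm i]
      exact le_iSup₂ (f := fun (k : Fin S.n) (_ : ¬ stalkIdeal (S.host k) x ≤ (maximalIdeal (X.presheaf.stalk x)) ^ 2) =>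
        stalkIdeal (S.host k * monomialIdeal (S.residualExps k)) x) i hi
  · refine sup_le (iSup₂_le fun i _ => ?_) (S.virtualResidual_stalk_le x 𝓝 h𝓝 h𝓝K)
    rw [hterm i, stalkIdeal_residual_K]
    exact le_iSup (fun k : Fin S.n => stalkIdeal (S.host k) x * ((S.residualExps k).map fun p => stalkIdeal p.1 x ^ p.2).prod) i

/-- **SWALLOWING (c′) in res-L1-w52-lead-1΄s pointwise `NDominates` currency**: `𝔑_x ≤ K♭_x` and
`K♭_x = (⨆_{(host i)_x ⊄ 𝔪_x²} termᵢ) ⊔ 𝔑_x` off `Supp Z`. [cite: Kollar2007, (3.111) Step 3] -/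
theorem swallowsAt_of_nDominatesAt [IsLocallyNoetherian X] (x : X) (Z : X.IdealSheafData) (hxZ : x ∉ (Z.support : Set X))
    (n₀ : ℕ) (𝓝 : List (X.IdealSheafData × ℕ)) (hbd : boundaryOf 𝓝 = S.𝓔) (hle : monomialIdeal 𝓝 ≤ S.K)
    (hpfx : ∀ j < n₀, S.𝓔[j]? = some Z)
    (hdom : ∀ i : Fin S.n, stalkIdeal (S.host i) x ≤ (maximalIdeal (X.presheaf.stalk x)) ^ 2 →
      ∀ j : ℕ, n₀ ≤ j → ∀ T : X.IdealSheafData, S.𝓔[j]? = some T → x ∈ (T.support : Set X) →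
        (𝓝.map Prod.snd).getD j 0 ≤ S.expAt i j) :
    stalkIdeal (monomialIdeal (S.𝓔.mapIdx fun j T =>
        (T, max ((𝓝.map Prod.snd).getD j 0) (S.minExpAt j) - S.minExpAt j))) x ≤ stalkIdeal S.residual.K x ∧
    stalkIdeal S.residual.K x =
      (⨆ (i : Fin S.n) (_ : ¬ stalkIdeal (S.host i) x ≤ (maximalIdeal (X.presheaf.stalk x)) ^ 2),
        stalkIdeal (S.host i * monomialIdeal (S.residualExps i)) x) ⊔
      stalkIdeal (monomialIdeal (S.𝓔.mapIdx fun j T =>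
        (T, max ((𝓝.map Prod.snd).getD j 0) (S.minExpAt j) - S.minExpAt j))) x :=
  ⟨S.virtualResidual_stalk_le x 𝓝 hbd (stalkIdeal_mono hle x),
    S.swallowsAt_of_virtual x Z hxZ 𝓝 hbd (stalkIdeal_mono hle x) fun i hi => S.dominates_of_prefix x Z n₀ 𝓝 hpfx (hdom i hi)⟩

end MultiHostState

end Summit.ResolutionOfSingularities.ResolutionOfSingularities.Theorems.DepthMultiHost

end
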